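import Summits.QuantumFields.YangMills.Theorems.Y2BridgeKing
import Summits.QuantumFields.YangMills.Theorems.BalabanLadderROTClassDefs
import Summits.QuantumFields.YangMills.Theses.BalabanLadder
import HarnessLib

/-!
# Route `BalabanLadder`, crux `ROT` (stmt-QuantumFields-20042): vocabulary of the line of record «King split» (v3)

Route-posited objects (D-0016 `<Route><Crux>Defs` file) shared by the registered stubs of the skeleton of record
`Cruxes/ROT/Lines/birth.lean` (v3, sha16 ff3050db3a1215f0; owner ym-beyond-p2, vocabulary and the King split by seat
ym-beyond-p4, refereed PASS) and by the Theorems-side files proving them (fleet lead `ym-spine-20042-p1`).  The skeleton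
keeps this vocabulary in the Cruxes-only namespace `YMBeyond.P4.ROT`, which no `Theorems/` file can import; the bodies
below are VERBATIM copies of its §B–§C declarations (same binders, same opens), re-homed to the Theorems namespace
`Summit.QuantumFields.YangMills.Theorems.ROT`, so that the registered stub signatures `stub_uvExtract : UVExtract` and
`stub_king : KingAll` are proved BY NAME against literally these statements.  NOTHING here is asserted: every
`def … : Prop` is a line statement some registered stub proves or consumes (none is a literature fact, none restates
the crux `Theses.BalabanLadder.ROT` as a claim).

* §1 schemes and off-diagonal limits: `IsLegScheme` (the common antecedent of `LatticeRotWard` / `LatticeKingWard`),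
  `OffDiagLimitAlong` (a one-field limit of the centred `a⁻⁴`-renormalised lattice `n`-point distributions off the
  diagonal along a subsequence), `UVCompactAt` (sequential compactness off the diagonal at `(G, r, a)`).
* §2 the two registered stub statements: `UVExtract` (`MomentBounds6 ⇒ UVCompactAt`, stub `stub_uvExtract`) and
  `KingAll` (King's finite-angle lattice rotation defects vanish at the Pythagorean angles in every unit `a → 0`,
  stub `stub_king` — the R2d content, open).

Refs: card `Cruxes/ROT/Lines/birth.md` (d73ac3a2b8cf7db3); C. King, Commun. Math. Phys. 103 (1986) 323–349, Thm 2.4;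
Glimm–Jaffe 1987 §6.1 (lattice approximation, subsequential limits); Osterwalder–Schrader 1973 §2 (`⁰𝒮`).
-/

set_option autoImplicit false

noncomputable section

open scoped SchwartzMap
open MeasureTheory Filter Topology
open Literature.MathematicalPhysics.QuantumFieldTheory Literature.MathematicalPhysics.QuantumLattice
open Literature.MathematicalPhysics.AQFT Literature.Probability.LatticeModels
open Summit.QuantumFields.YangMills.Cruxes.OSLegsFromFemtoAndGap.DlrCollarTransfer
open Summit.QuantumFields.YangMills.Cruxes.OSLegsAtWeakCouplingC.Sketch
open Summit.QuantumFields.YangMills.Cruxes.OSLegsAtWeakCouplingC.Y2Bridge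
open Summit.QuantumFields.YangMills.Theorems.OSLegsFromFemtoAndGap (latticeDist)
open Summit.QuantumFields.YangMills.Theorems.NPointIsotropy.Negative (E4)

namespace Summit.QuantumFields.YangMills.Theorems.ROT

/-! ## §1 Schemes of the legs and off-diagonal limits (tree notions only) -/

section Vocabulary

variable {G : Type} [Group G] [TopologicalSpace G] [IsTopologicalGroup G] [CompactSpace G]
  [MeasurableSpace G] [BorelSpace G]

/-- **Admissible schemes of the legs**: units `a` (`a_k = a(β_k)`), `β_k → ∞`, and the soft-bundle torus ranges
`0 ≤ β_k`, `a_k ≤ 1/24`, `14 ≤ L_k`, `a_k⁻² ≤ L_k` — the common antecedent of `LatticeRotWard` / `LatticeKingWard`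
(verbatim the skeleton's `YMBeyond.P4.ROT.IsLegScheme`). -/
def IsLegScheme (a : ℝ → ℝ) (sch : SpeciesScheme (YMSpecies G)) : Prop :=
  (∀ k, sch.a k = a (sch.β k)) ∧ Tendsto sch.β atTop atTop ∧
    (∀ k, 0 ≤ sch.β k ∧ sch.a k ≤ 1 / 24 ∧ 14 ≤ sch.L k ∧ (sch.a k)⁻¹ * (sch.a k)⁻¹ ≤ sch.L k)

/-- **Off-diagonal limit along a subsequence `φ` of a scheme**: a one-field family `S₁` with vanishing one-point
function and bounded densities off the diagonal to which the centred, `a⁻⁴`-renormalised lattice `n`-point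
distributions (`n ≥ 2`) of the action density converge on off-diagonal test functions (three clauses of the tree's
`SoftBundle`, nothing else; verbatim the skeleton's `YMBeyond.P4.ROT.OffDiagLimitAlong`). -/
def OffDiagLimitAlong (r : LatticeRep G) (sch : SpeciesScheme (YMSpecies G)) (φ : ℕ → ℕ)
    (S₁ : SchwingerFamily E4) : Prop :=
  (∀ F : 𝓢((Fin 1 → E4), ℂ), S₁ 1 F = 0) ∧ OffDiagDensity S₁ ∧
    ∀ (n : ℕ), 2 ≤ n → ∀ F : 𝓢((Fin n → E4), ℂ), IsOffDiagonal F →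
      Tendsto (fun j => latticeDist r.ρ (sch.β (φ j)) (sch.L (φ j)) (sch.a (φ j)) r.curvature.F
        (wilsonTorusMean r.ρ (sch.β (φ j)) (sch.L (φ j)) r.curvature.F) n F) atTop (𝓝 (S₁ n F))

/-- **UV sequential compactness off the diagonal at `(G, r, a)`**: every subsequence of every admissible scheme has
a further subsequence with an off-diagonal limit (verbatim the skeleton's `YMBeyond.P4.ROT.UVCompactAt`). -/
def UVCompactAt (r : LatticeRep G) (a : ℝ → ℝ) : Prop :=
  ∀ sch : SpeciesScheme (YMSpecies G), IsLegScheme a sch → ∀ φ : ℕ → ℕ, Tendsto φ atTop atTop →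
    ∃ ψ : ℕ → ℕ, StrictMono ψ ∧ ∃ S₁ : SchwingerFamily E4, OffDiagLimitAlong r sch (φ ∘ ψ) S₁

end Vocabulary

/-! ## §2 The two registered stub statements of the King split -/

/-- **Statement of `stub_uvExtract` — UV extraction**: for every compact simple `G`, every lattice representation
`r` and every positive unit map `a → 0`, the plane-resolved hyperscaling moment bounds `MomentBounds6 G r a` give
sequential compactness off the diagonal `UVCompactAt r a` (verbatim the skeleton's `YMBeyond.P4.ROT.UVExtract`;
M-sized: a-uniform `⁰𝒮` bounds, diagonal subsequence, Hahn–Banach, Riemann sums). -/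
def UVExtract : Prop :=
  ∀ (G : Type) [Group G] [TopologicalSpace G] [IsTopologicalGroup G] [CompactSpace G],
    IsCompactSimpleLieGroup G → letI : MeasurableSpace G := borel G; haveI : BorelSpace G := ⟨rfl⟩;
    ∀ (r : LatticeRep G) (a : ℝ → ℝ), (∀ β, 0 < a β) → Tendsto a atTop (𝓝 0) →
      MomentBounds6 G r a → UVCompactAt r a

/-- **Statement of `stub_king` — KING, un-guarded (the R2d content; open)**: King's finite-angle lattice rotation
defects vanish at every Pythagorean angle, along every admissible scheme, for every compact simple `G`, every `r`
and EVERY positive unit map `a → 0` (verbatim the skeleton's `YMBeyond.P4.ROT.KingAll`; C. King, CMP 103 (1986)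
Thm 2.4 is the abelian-Higgs `d = 2, 3` model of the mechanism — the two-lattice comparison through the crossover is
not in print for YM₄). -/
def KingAll : Prop :=
  ∀ (G : Type) [Group G] [TopologicalSpace G] [IsTopologicalGroup G] [CompactSpace G],
    IsCompactSimpleLieGroup G → letI : MeasurableSpace G := borel G; haveI : BorelSpace G := ⟨rfl⟩;
    ∀ (r : LatticeRep G) (a : ℝ → ℝ), (∀ β, 0 < a β) → Tendsto a atTop (𝓝 0) →
      LatticeKingWard G r a (King.pythagoreanAngles : Set ℝ)

/-! ## §3 The UV-guarded forms of the King input (appended 2026-08-26; candidate v4 stub texts, owner's choice)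

After `stub_uvExtract` landed (`Theorems/BalabanLadderROTUVExtract.lean`), the lead's reading of `stub_king`
(`Theorems/BalabanLadderROTOfKing.lean`, `…SingleAngle.lean`; evidence `FINDING-20042-stub_king-reading.md`) isolates two WEAKER,
UV-CONSUMING forms of the King input with kernel-checked closers (`rot_of_kingLimit`, `rot_of_kingSingle`): `KingAll ⇒ KingLimit ⇒
KingSingle`, and in `MomentBounds6` units `KingSingle`'s body is equivalent to the crux's conclusion `LatticeRotWard`
(`latticeKingWard_single_iff_latticeRotWard_of_momentBounds6`).  They are typed here so that a re-registered skeleton can state its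
stub over a bare identifier.  Nothing is asserted. -/

/-- **`KingLimit` — the King input in limit-point form, UV-guarded**: for every compact simple `G`, every `r`, every positive unit
map `a → 0` carrying `MomentBounds6 G r a`, and every admissible scheme, there is a germ radius `r₀ > 0` such that every
off-diagonal limit point `S₁` along every subsequence `φ → ∞` is invariant on King's class `KingClass n r₀` (`n ≥ 2`) under the
rotations of the `(x₀,x₁)`-plane by every Pythagorean angle.  `KingAll → KingLimit` (uniqueness of limits); closer
`Theorems.ROT.rot_of_kingLimit : ‹body› → Theses.BalabanLadder.ROT`. -/
def KingLimit : Prop :=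
  ∀ (G : Type) [Group G] [TopologicalSpace G] [IsTopologicalGroup G] [CompactSpace G],
    IsCompactSimpleLieGroup G → letI : MeasurableSpace G := borel G; haveI : BorelSpace G := ⟨rfl⟩;
    ∀ (r : LatticeRep G) (a : ℝ → ℝ), (∀ β, 0 < a β) → Tendsto a atTop (𝓝 0) → MomentBounds6 G r a →
      ∀ sch : SpeciesScheme (YMSpecies G), IsLegScheme a sch → ∃ r₀ : ℝ, 0 < r₀ ∧
        ∀ φ : ℕ → ℕ, Tendsto φ atTop atTop → ∀ S₁ : SchwingerFamily E4, OffDiagLimitAlong r sch φ S₁ →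
          ∀ (n : ℕ), 2 ≤ n → ∀ F ∈ King.KingClass n r₀, ∀ θ ∈ (King.pythagoreanAngles : Set ℝ),
            S₁ n (linActMulti (planeRot (0 : Fin 3) θ) F) = S₁ n F

/-- **`KingSingle` — the King input at King's ONE angle, UV-guarded, lattice form**: for every compact simple `G`, every `r` and
every positive unit map `a → 0` carrying `MomentBounds6 G r a`, the finite-angle lattice rotation defects of the centred
`a⁻⁴`-renormalised `n`-point distributions of `tr F²` vanish along every admissible scheme at the single angle
`θ₀ = arcsin (3/5)` (`cos θ₀ = 4/5`: the `(3,4,5)` lattice pair of C. King, CMP 103 (1986) Thm 2.4 — ONE two-lattice comparison).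
`KingAll → KingSingle` (monotonicity in the angle set); closer `Theorems.ROT.rot_of_kingSingle`; in these units the body is
EQUIVALENT to `LatticeRotWard G r a` (`latticeKingWard_single_iff_latticeRotWard_of_momentBounds6`). -/
def KingSingle : Prop :=
  ∀ (G : Type) [Group G] [TopologicalSpace G] [IsTopologicalGroup G] [CompactSpace G],
    IsCompactSimpleLieGroup G → letI : MeasurableSpace G := borel G; haveI : BorelSpace G := ⟨rfl⟩;
    ∀ (r : LatticeRep G) (a : ℝ → ℝ), (∀ β, 0 < a β) → Tendsto a atTop (𝓝 0) → MomentBounds6 G r a →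
      LatticeKingWard G r a ({Real.arcsin (3 / 5)} : Set ℝ)

/-! ## §4 The IR-guarded forms of the King input (appended 2026-08-26, g2; candidate v5 stub texts, owner's / planner's call)

LOCATED FINDING of the lead's g2 seat (`FINDING-20042-IR-guard.md`, evidence on stmt-QuantumFields-20042; kernel-checked companions
`Theorems/BalabanLadderROTGuardIR.lean`, `Theorems/BalabanLadderROTCommensurability.lean`): King's printed mechanism (CMP 103 (1986)
Thm 2.4 via Prop. 4.1 / Thm 4.2) compares the two orientations on ONE FIXED torus fitted by both lattices, with error estimates carrying
the volume factor `|D_J|` ((4.5)–(4.9)), and reaches the physical theory only CONDITIONALLY on the periodic infinite-volume limit (2.24)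
«cluster expansion»; the crux's schemes have DIVERGING physical volume (`SpeciesScheme.tendsto_L`; `tendsto_physicalSide_atTop`), so a
King-type proof of `KingLimit` / `KingSingle` / `ROT` consumes a volume-uniform locality input at the physical scale — in the route's
vocabulary the infrared leg `GapInUnits G r a`, which `Theses.BalabanLadder.closes` holds at the same `(r, a)` when it invokes `ROT` but
which `ROT` (rev 1) does not carry.  The texts below insert that guard; `Theorems.ROT.rotIR_of_kingLimitIR` / `rotIR_of_kingSingleIR` are
their closers to the correspondingly guarded rotation leg, `kingLimitIR_iff_kingSingleIR` their equivalence, `kingLimitIR_of_kingLimit`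
the comparison with §3 (the guarded text is WEAKER), and `closes_of_rotIR` the proof that the guarded rotation leg closes the route with
the other five items unchanged.  Nothing is asserted; no route item is re-typed here (that is the owner's `route edit`). -/

/-- **`KingLimitIR` — the King input in limit-point form, UV- AND IR-guarded** (candidate v5 stub text): `KingLimit` (§3) with the
infrared leg's conclusion `GapInUnits G r a` at the same `(r, a)` as an additional hypothesis — the volume-uniform clustering that
King's two-orientation comparison consumes on tori of diverging physical size (CMP 103 (1986) Thm 4.2: error `∝ |D_J|`; (2.24)).
`KingLimit → KingLimitIR` (`kingLimitIR_of_kingLimit`); closer `Theorems.ROT.rotIR_of_kingLimitIR`. -/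
def KingLimitIR : Prop :=
  ∀ (G : Type) [Group G] [TopologicalSpace G] [IsTopologicalGroup G] [CompactSpace G],
    IsCompactSimpleLieGroup G → letI : MeasurableSpace G := borel G; haveI : BorelSpace G := ⟨rfl⟩;
    ∀ (r : LatticeRep G) (a : ℝ → ℝ), (∀ β, 0 < a β) → Tendsto a atTop (𝓝 0) → MomentBounds6 G r a →
      GapInUnits G r a →
      ∀ sch : SpeciesScheme (YMSpecies G), IsLegScheme a sch → ∃ r₀ : ℝ, 0 < r₀ ∧
        ∀ φ : ℕ → ℕ, Tendsto φ atTop atTop → ∀ S₁ : SchwingerFamily E4, OffDiagLimitAlong r sch φ S₁ →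
          ∀ (n : ℕ), 2 ≤ n → ∀ F ∈ King.KingClass n r₀, ∀ θ ∈ (King.pythagoreanAngles : Set ℝ),
            S₁ n (linActMulti (planeRot (0 : Fin 3) θ) F) = S₁ n F

/-- **`KingSingleIR` — the King input at King's ONE angle, UV- AND IR-guarded, lattice form** (candidate v5 stub text): `KingSingle`
(§3) with `GapInUnits G r a` inserted; equivalent to `KingLimitIR` (`Theorems.ROT.kingLimitIR_iff_kingSingleIR`); closer
`Theorems.ROT.rotIR_of_kingSingleIR`.  [C. King, CMP 103 (1986) Thm 2.4 — the `(3,4,5)` pair — mechanism] -/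
def KingSingleIR : Prop :=
  ∀ (G : Type) [Group G] [TopologicalSpace G] [IsTopologicalGroup G] [CompactSpace G],
    IsCompactSimpleLieGroup G → letI : MeasurableSpace G := borel G; haveI : BorelSpace G := ⟨rfl⟩;
    ∀ (r : LatticeRep G) (a : ℝ → ℝ), (∀ β, 0 < a β) → Tendsto a atTop (𝓝 0) → MomentBounds6 G r a →
      GapInUnits G r a → LatticeKingWard G r a ({Real.arcsin (3 / 5)} : Set ℝ)

/-! ## §5 The IR-guarded forms of the King input ON A TORUS CLASS (appended 2026-08-26, g3; candidate v6 stub texts, owner's call)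

Owner's ruling of 2026-08-26T17:18:42Z, (3)(b)–(c), and `R85-BATCH-EDITS.md` item 3: with the bridge re-run `BridgeOnClass` PROVED
(`Theorems/BalabanLadderROTBridgeOnClass.lean`, g2) the rotation leg is owed on ONE unbounded torus class of the mechanism's choosing
(`ROT` rev 2′ := `… → LowerBounds → MomentBounds6 → GapInUnits → ∃ S, UnboundedClass S ∧ LatticeRotWardOn G r a S`), and the v6 skeleton
«king-limit-IR-on» states its one stub over the bare identifier `KingLimitIROn S` below at a FITTED class (`S₅ = {L | 5 ∣ 2L+1}` for King's
`(3,4,5)` pair, `unboundedClass_fitted 2`; or `S₁₃`, `S₁₅`, … — `Theorems/BalabanLadderROTOnClassLimit.lean`).  The two texts are §4's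
`KingLimitIR` / `KingSingleIR` with the class condition `∀ k, sch.L k ∈ S` placed beside the scheme's admissibility, nothing else; their
equivalence, antitonicity in `S`, the comparison with §4 (`S = univ`) and the closer `rot2'_of_kingLimitIROn` are kernel-checked in
`Theorems/BalabanLadderROTOnClassLimit.lean`.  consumes (LINE №57): `MomentBounds6` ↦ compactness (`stub_uvExtract`) + density of the limit
points; `GapInUnits` ↦ the volume-uniform locality of King's two-orientation comparison on the diverging FITTED tori of the class (CMP 103
(1986) Thm 4.2, (4.9) `∝ |D_J|`; interpolated measures, caveat (i′)) and the tilt insensitivity of the axis theory (straight torus `ℝ⁴/Nℤ⁴`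
vs tilted torus `ℝ⁴/R(Nℤ⁴)`, King II (2.24)–(2.25); caveat (iii′), ym-beyond-p4 g17 N-ROT memo v2 §5(a)); the class removes the torus-SIZE
transfer only.  Nothing is asserted; no route item is re-typed here. -/

/-- **`KingLimitIROn S` — the King input in limit-point form, UV- and IR-guarded, ON THE TORUS CLASS `S`** (candidate v6 stub text, owner's
(3)(b) of 2026-08-26T17:18:42Z): `KingLimitIR` (§4) asked only along the admissible schemes whose torus half-sides all lie in `S`
(`∀ k, sch.L k ∈ S` beside `IsLegScheme a sch`).  `KingLimitIR → KingLimitIROn S` and `KingLimitIROn T → KingLimitIROn S` for `S ⊆ T`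
(`Theorems.ROT.kingLimitIROn_of_kingLimitIR`, `kingLimitIROn_anti`); `KingLimitIROn univ ↔ KingLimitIR`; closer
`Theorems.ROT.rot2'_of_kingLimitIROn : UnboundedClass S → KingLimitIROn S → ‹ROT rev 2′›`. [C. King, CMP 103 (1986) Thm 2.4 on tori fitted by
both lattices — mechanism; for YM₄ unprinted] -/
def KingLimitIROn (S : Set ℕ) : Prop :=
  ∀ (G : Type) [Group G] [TopologicalSpace G] [IsTopologicalGroup G] [CompactSpace G],
    IsCompactSimpleLieGroup G → letI : MeasurableSpace G := borel G; haveI : BorelSpace G := ⟨rfl⟩;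
    ∀ (r : LatticeRep G) (a : ℝ → ℝ), (∀ β, 0 < a β) → Tendsto a atTop (𝓝 0) → MomentBounds6 G r a →
      GapInUnits G r a →
      ∀ sch : SpeciesScheme (YMSpecies G), (∀ k, sch.L k ∈ S) → IsLegScheme a sch → ∃ r₀ : ℝ, 0 < r₀ ∧
        ∀ φ : ℕ → ℕ, Tendsto φ atTop atTop → ∀ S₁ : SchwingerFamily E4, OffDiagLimitAlong r sch φ S₁ →
          ∀ (n : ℕ), 2 ≤ n → ∀ F ∈ King.KingClass n r₀, ∀ θ ∈ (King.pythagoreanAngles : Set ℝ),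
            S₁ n (linActMulti (planeRot (0 : Fin 3) θ) F) = S₁ n F

/-- **`KingSingleIROn S` — the King input at King's ONE angle, UV- and IR-guarded, lattice form, ON THE TORUS CLASS `S`** (candidate v6
stub text, lattice variant): `KingSingleIR` (§4) asked only along the admissible schemes with tori in `S`, i.e. the guards followed by
`LatticeKingWardOn G r a {arcsin (3/5)} S` (`Theorems/BalabanLadderROTClassDefs.lean` §3).  Equivalent to `KingLimitIROn S`
(`Theorems.ROT.kingLimitIROn_iff_kingSingleIROn`) and, in these units, to the rev-2′ conclusion on the class
(`Theorems.ROT.kingSingleIROn_iff_rotIROn`); `KingSingleIROn S → KingOnClass` for unbounded `S` (`kingOnClass_of_kingSingleIROn`).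
[C. King, CMP 103 (1986) Thm 2.4 — the `(3,4,5)` pair on tori with `5 ∣ 2L+1` — mechanism] -/
def KingSingleIROn (S : Set ℕ) : Prop :=
  ∀ (G : Type) [Group G] [TopologicalSpace G] [IsTopologicalGroup G] [CompactSpace G],
    IsCompactSimpleLieGroup G → letI : MeasurableSpace G := borel G; haveI : BorelSpace G := ⟨rfl⟩;
    ∀ (r : LatticeRep G) (a : ℝ → ℝ), (∀ β, 0 < a β) → Tendsto a atTop (𝓝 0) → MomentBounds6 G r a →
      GapInUnits G r a → LatticeKingWardOn G r a ({Real.arcsin (3 / 5)} : Set ℝ) S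

end Summit.QuantumFields.YangMills.Theorems.ROT

end
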